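/-
Copyright (c) 2026 the pub-hodgecm-mathlib formalisation cell (harness21).  Prover seat hodgecm-mathlib-R90-C133-p02 (g2), Track B ∕ R90-TF, h413 = `stmt-HodgeConjecture-24833`,
R90-TF section S8 «ContSpec-n½» (S8-R211 (3) ∕ S8-R213 (a): the (INV) road in ESTATE T's τ-ADMISSIBLE vocabulary ★ p864157): THE LEDGER OF RECORD FOR THE (R)′ LETTER `hDISC` IN
THE τ-VOCABULARY — `hDISC` from {K2E1-p10's `hW1 : resGMidBlock ≤ resGMidBlockτ`, `hTRANSτ` «right translates of τ-admissible generators stay in the closed span of the τ-admissible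
generators»}, everything else ★ (level antitone ★ p863816, `K_max`-finiteness of τ-admissible sections ★ `R90S8ResGMidAtomTauLawsKMaxU3`, β2 ★ p864185, unitarity ★ p864252).
-/
import Summits.HodgeConjecture.HodgeConjecture.Theorems.R90S8ResGMidAtomInvOfKFiniteTranslationU3   -- ★ p864277 (β3); brings ★ p864252 (`hSUM_holds`), ★ β2 p864185 (`hW1prime_of_kFinite`), ★ p863995 (`finiteDimensional_homRangeSum_resGMidAtom_bot_of_letters`), ★ p863816 (`finiteDimensional_homRangeSum_toContRep_of_le_of_adm`, `chiSectionSpacePair_le_bot`, `resGMidAtomGen_subset_resGMidAtomGen_bot`, `restrict_apply_mem_resGMidAtom_bot`)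
import Summits.HodgeConjecture.HodgeConjecture.Theorems.R90S8ResGMidAtomTauLawsKMaxU3               -- ★ ESTATE T laws (K2E1-p12 (g6)): `finiteDimensional_span_comp_subtype_kMax_of_mem_chiSectionSpacePair_tauLevel`; brings ★ τ-DEFS p864157 `IsTauLevel`, `tauLevel`, `resGMidAtomGenτ`, `resGMidAtomτ`, `resGMidBlockτ`, `resGMidBlockτ_le`, `resGMidAtomGenτ_subset`
import HarnessLib

/-!
# S8 (R)′ road — `R90S8ResGMidBlockDiscreteOfTauRecordU3`: `hDISC` OF RECORD IN THE τ-ADMISSIBLE VOCABULARY — ★ modulo {`hW1 : resGMidBlock ≤ resGMidBlockτ`, `hTRANSτ`}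

Track B ∕ R90-TF, crux h413 = `stmt-HodgeConjecture-24833`, route of record `HCCMUnconditional`; cell `hodgecm-mathlib`, R90-TF section S8 «ContSpec-n½ ∕ ResidualSpectrum», socket (R)
(B ED. 7 :337) ← ★ `res_midBlock_le_residual_of_letters' (hDISC) …` ← ★ p863816 `hDISC_of_inv_of_admissible`.  THEOREMS ONLY (no `def`, no `instance`, no `notation`, no named-fact
hypothesis, no `sorry`; default heartbeats); lane `--supports stmt-HodgeConjecture-24833 --as helper` (count-neutral).  CLOSES NO SOCKET.  JUNCTION: the density letter here IS K2E1-p10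
(g5)'s `hW1 : resGMidBlock ξ μω ≤ resGMidBlockτ ξ μω` of `R90S8ResGMidBlockLeResidualOfTauAdmissibleU3` — ONE shared letter for the (R)′ row — and the invariance letter is `hTRANSτ`:
for every `g ∈ G(𝔸)` and every τ-ADMISSIBLE generator `f` (★ `resGMidAtomGenτ ξ μω U₀`, `IsTauLevel U₀`), `R(g) f ∈ cl span (all τ-admissible generators)` — «the closed span of the
`K`-finite middle-pole residues is `G(𝔸)`-stable» [MW95 II.1, V.3.13; BJ79 §4.6], whose finite-adelic half is M modulo ESTATE T's exports (census `CENSUS-hTRANS-payer` 8d98775fd52c510b)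
and whose archimedean half is the analytic-vector item.

THE MATHEMATICS.  `G_τ := ⋃_{U₀ τ-level} resGMidAtomGenτ ξ μω U₀`.  §1: every τ-admissible generator is a `K_max`-FINITE level-`⊥` generator (level antitone ★ `chiSectionSpacePair_le_bot` + ★
`finiteDimensional_span_comp_subtype_kMax_of_mem_chiSectionSpacePair_tauLevel`), so `G_τ ⊆ G_fin`; and `G_τ ⊆ A_⊥ := resGMidAtom ξ μω ⊥ 1`.  §2: `hTRANSτ` makes `cl span G_τ` a closed
`R(G(𝔸))`-INVARIANT subspace containing every τ-atom, so `resGMidBlockτ ≤ cl span G_τ` (★ minimality `resGMidBlockτ_le`); with `hW1`: `resGMidBlock ≤ cl span G_τ ≤ A_⊥` (`A_⊥` closed ★) and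
`A_⊥ ≤ resGMidBlock ≤ cl span G_τ ≤ cl span G_fin` — i.e. BOTH the (W1) `K_max`-finite density AND `B ≤ A_⊥`.  §3: ★ β2 + ★ `hSUM_holds` turn (W1) into the admissibility of `A_⊥` (★
p863995), and ★ p863816's generic descent `finiteDimensional_homRangeSum_toContRep_of_le_of_adm` along `B ≤ A_⊥` gives the `hDISC` bytes.
* §1 `resGMidAtomGenτ_subset_kFiniteGen`, `tauGenerators_subset_kFiniteGen`, `tauGenerators_subset_resGMidAtom_bot`, `span_tauGenerators_le_resGMidAtom_bot`.
* §2 `toSubmodule_resGMidBlockτ_le_closure_span_of_translation (hTRANSτ)`, `toSubmodule_resGMidBlock_le_resGMidAtom_bot_of_tau (hW1) (hTRANSτ)`, `resGMidAtom_bot_le_closure_span_kFinite_of_tau (hW1) (hTRANSτ)`.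
* §3 **`finiteDimensional_homRangeSum_resGMidBlock_of_tau (hμu) (hW1) (hTRANSτ)`** (one `(L, μ, ξ, μω)`; conclusion = ★ p863816's per-instance `hDISC` shape) and the ∀-closed
  **`hDISC_of_tauRecord (hW1) (hTRANSτ) : ‹hDISC binder bytes of ★ p863422 ∕ p863518 VERBATIM›`**.
HONEST LABEL: HC_CM is proved only modulo the 7 printed citations (2 remaining named inputs: hLiu418 = `stmt-HodgeConjecture-24832`, h413 = `stmt-HodgeConjecture-24833`) until
rung 0 closes; REL ≠ ★ ≠ BUILT; `hDISC` = ★ ∘ {`hW1` (L, unprinted as typed at exotic generators — J-S8-W1), `hTRANSτ` (= (T_f) M mod `hEXPτ` + (T_∞) L)}; pays no socket; count-neutral.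

## References
* [MoeglinWaldspurger1995] C. Mœglin, J.-L. Waldspurger, *Spectral Decomposition and Eisenstein Series* (1995), I.2.17–I.2.18, II.1, V.3.13.
* [BorelJacquet1979] A. Borel, H. Jacquet, *Automorphic forms and automorphic representations*, Corvallis PSPM 33.1 (1979), §4.6.
* [Rogawski1990] J. D. Rogawski, *Automorphic Representations of Unitary Groups in Three Variables* (1990), §13.9 p. 229 (ii).
-/

set_option autoImplicit false
set_option linter.dupNamespace false  -- the mandated namespace `…HodgeConjecture.HodgeConjecture.R90.S8` (LEAD #1 L1) repeats the summit's segment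

noncomputable section

open MeasureTheory Measure Set Filter Topology NumberField ContRepresentation
open Literature.NumberTheory Literature.NumberTheory.Automorphic Literature.NumberTheory.Automorphic.UnitaryGroup Literature.NumberTheory.GaloisRepresentations AdelicGroupData
open Literature.NumberTheory.Automorphic.Arthur2013.Leaves.TECR Literature.NumberTheory.Rogawski1990
open Summit.HodgeConjecture.HodgeConjecture.Cruxes.H413.K2E1BorelEisensteinU
open Summit.HodgeConjecture.HodgeConjecture.Cruxes.H413.K2E1CharacterEisensteinU3PairDefs
open Summit.HodgeConjecture.HodgeConjecture.Cruxes.H413.K2E1ChiSectionSpaceU3PairDefs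
open scoped ENNReal NNReal

namespace Summit.HodgeConjecture.HodgeConjecture.R90.S8

section Main

variable (L : Type) [Field L] [NumberField L] [IsCMField L]
  (μ : Measure (quasiSplit (↥(maximalRealSubfield L)) L (IsCMField.complexConj L) 3).automorphicQuotient)
  [(quasiSplit (↥(maximalRealSubfield L)) L (IsCMField.complexConj L) 3).IsAutomorphicMeasure μ]
  (ξ : OneDimAutRepH L) (μω : HeckeCharacter L)

/-! ## §1 τ-admissible generators are `K_max`-finite level-`⊥` generators, and lie in the level-free atom -/

omit [(quasiSplit (↥(maximalRealSubfield L)) L (IsCMField.complexConj L) 3).IsAutomorphicMeasure μ] in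
/-- **Every τ-admissible generator at a τ-level `U₀` is a `K_max`-FINITE level-`⊥` generator** (★ level antitone + ★ ESTATE T `K_max`-finiteness of arch-finite sections at a τ-level).
[cite: MoeglinWaldspurger1995, I.2.17] [cite: BorelJacquet1979, §4.6] -/
theorem resGMidAtomGenτ_subset_kFiniteGen {U₀ : Subgroup ↥(finAdelic (↥(maximalRealSubfield L)) L (IsCMField.complexConj L) 3 ((StdForm.antidiagonal 3).over L))} (hU₀ : IsTauLevel L U₀) :
    resGMidAtomGenτ L μ ξ μω U₀ ⊆ {f : (quasiSplit (↥(maximalRealSubfield L)) L (IsCMField.complexConj L) 3).L2 μ | ∃ φ : (quasiSplit (↥(maximalRealSubfield L)) L (IsCMField.complexConj L) 3).Adelic → ℂ, (φ ∈ chiSectionSpacePair (ξ.bcη⁻¹ * ξ.bcψ⁻¹ * μω) ξ.ψ (⊥ : Subgroup (quasiSplit (↥(maximalRealSubfield L)) L (IsCMField.complexConj L) 3).Adelic)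
          ((1 : ↥(⊥ : Subgroup (quasiSplit (↥(maximalRealSubfield L)) L (IsCMField.complexConj L) 3).Adelic) →* ℂ) : ↥(⊥ : Subgroup (quasiSplit (↥(maximalRealSubfield L)) L (IsCMField.complexConj L) 3).Adelic) → ℂ) ∧ Continuous φ ∧
          ∃ (Ec : ℂ → (quasiSplit (↥(maximalRealSubfield L)) L (IsCMField.complexConj L) 3).Adelic → ℂ) (Sp : Finset ℂ)
            (_ : ∀ s ∈ Sp, s.im = 0 ∧ 1 < s.re ∧ s.re ≤ 2)
            (_ : ∀ g, DifferentiableOn ℂ (fun z => Ec z g) ({z : ℂ | 1 < z.re} \ (↑Sp : Set ℂ)))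
            (_ : ∀ z : ℂ, 2 < z.re → Ec z = eisensteinSeriesU (flatSectionU φ z))
            (Fp : (quasiSplit (↥(maximalRealSubfield L)) L (IsCMField.complexConj L) 3).Adelic → ℂ → ℂ)
            (_ : ∀ g, AnalyticAt ℂ (Fp g) ((3 : ℂ) / 2))
            (_ : ∀ g, Fp g =ᶠ[𝓝[≠] ((3 : ℂ) / 2)] fun z => (z - (3 : ℂ) / 2) * Ec z g),
            (f : (quasiSplit (↥(maximalRealSubfield L)) L (IsCMField.complexConj L) 3).automorphicQuotient → ℂ) =ᵐ[μ] (fun x : (quasiSplit (↥(maximalRealSubfield L)) L (IsCMField.complexConj L) 3).automorphicQuotient => Fp (Quotient.out (x : ((quasiSplit (↥(maximalRealSubfield L)) L (IsCMField.complexConj L) 3).Adelic ⧸ (quasiSplit (↥(maximalRealSubfield L)) L (IsCMField.complexConj L) 3).quotientSubgroup)))⁻¹ ((3 : ℂ) / 2))) ∧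
          FiniteDimensional ℂ ↥(Submodule.span ℂ (Set.range fun k : ↥((standardMaximalCompactGL 3 L).comap (adelicVal (↥(maximalRealSubfield L)) L (IsCMField.complexConj L) 3 ((StdForm.antidiagonal 3).over L)) :
      Subgroup (quasiSplit (↥(maximalRealSubfield L)) L (IsCMField.complexConj L) 3).Adelic) => ((rightTranslation (quasiSplit (↥(maximalRealSubfield L)) L (IsCMField.complexConj L) 3)).comp ((standardMaximalCompactGL 3 L).comap (adelicVal (↥(maximalRealSubfield L)) L (IsCMField.complexConj L) 3 ((StdForm.antidiagonal 3).over L)) :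
      Subgroup (quasiSplit (↥(maximalRealSubfield L)) L (IsCMField.complexConj L) 3).Adelic).subtype) k φ))} := by
  rintro f ⟨φ, hφ, hc, hφa, Ec, Sp, hSp, hol, hEc, Fp, hF, hFE, hae⟩
  exact ⟨φ, ⟨chiSectionSpacePair_le_bot L (tauLevel L U₀) 1 hφ, hc, Ec, Sp, hSp, hol, hEc, Fp, hF, hFE, hae⟩,
    finiteDimensional_span_comp_subtype_kMax_of_mem_chiSectionSpacePair_tauLevel L hU₀ hφ hφa⟩

omit [(quasiSplit (↥(maximalRealSubfield L)) L (IsCMField.complexConj L) 3).IsAutomorphicMeasure μ] in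
/-- **`G_τ ⊆ G_fin`**: the union over the τ-levels. [cite: MoeglinWaldspurger1995, I.2.17] -/
theorem tauGenerators_subset_kFiniteGen :
    (⋃ (U₀ : Subgroup ↥(finAdelic (↥(maximalRealSubfield L)) L (IsCMField.complexConj L) 3 ((StdForm.antidiagonal 3).over L))) (_ : IsTauLevel L U₀), resGMidAtomGenτ L μ ξ μω U₀) ⊆ {f : (quasiSplit (↥(maximalRealSubfield L)) L (IsCMField.complexConj L) 3).L2 μ | ∃ φ : (quasiSplit (↥(maximalRealSubfield L)) L (IsCMField.complexConj L) 3).Adelic → ℂ, (φ ∈ chiSectionSpacePair (ξ.bcη⁻¹ * ξ.bcψ⁻¹ * μω) ξ.ψ (⊥ : Subgroup (quasiSplit (↥(maximalRealSubfield L)) L (IsCMField.complexConj L) 3).Adelic)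
          ((1 : ↥(⊥ : Subgroup (quasiSplit (↥(maximalRealSubfield L)) L (IsCMField.complexConj L) 3).Adelic) →* ℂ) : ↥(⊥ : Subgroup (quasiSplit (↥(maximalRealSubfield L)) L (IsCMField.complexConj L) 3).Adelic) → ℂ) ∧ Continuous φ ∧
          ∃ (Ec : ℂ → (quasiSplit (↥(maximalRealSubfield L)) L (IsCMField.complexConj L) 3).Adelic → ℂ) (Sp : Finset ℂ)
            (_ : ∀ s ∈ Sp, s.im = 0 ∧ 1 < s.re ∧ s.re ≤ 2)
            (_ : ∀ g, DifferentiableOn ℂ (fun z => Ec z g) ({z : ℂ | 1 < z.re} \ (↑Sp : Set ℂ)))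
            (_ : ∀ z : ℂ, 2 < z.re → Ec z = eisensteinSeriesU (flatSectionU φ z))
            (Fp : (quasiSplit (↥(maximalRealSubfield L)) L (IsCMField.complexConj L) 3).Adelic → ℂ → ℂ)
            (_ : ∀ g, AnalyticAt ℂ (Fp g) ((3 : ℂ) / 2))
            (_ : ∀ g, Fp g =ᶠ[𝓝[≠] ((3 : ℂ) / 2)] fun z => (z - (3 : ℂ) / 2) * Ec z g),
            (f : (quasiSplit (↥(maximalRealSubfield L)) L (IsCMField.complexConj L) 3).automorphicQuotient → ℂ) =ᵐ[μ] (fun x : (quasiSplit (↥(maximalRealSubfield L)) L (IsCMField.complexConj L) 3).automorphicQuotient => Fp (Quotient.out (x : ((quasiSplit (↥(maximalRealSubfield L)) L (IsCMField.complexConj L) 3).Adelic ⧸ (quasiSplit (↥(maximalRealSubfield L)) L (IsCMField.complexConj L) 3).quotientSubgroup)))⁻¹ ((3 : ℂ) / 2))) ∧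
          FiniteDimensional ℂ ↥(Submodule.span ℂ (Set.range fun k : ↥((standardMaximalCompactGL 3 L).comap (adelicVal (↥(maximalRealSubfield L)) L (IsCMField.complexConj L) 3 ((StdForm.antidiagonal 3).over L)) :
      Subgroup (quasiSplit (↥(maximalRealSubfield L)) L (IsCMField.complexConj L) 3).Adelic) => ((rightTranslation (quasiSplit (↥(maximalRealSubfield L)) L (IsCMField.complexConj L) 3)).comp ((standardMaximalCompactGL 3 L).comap (adelicVal (↥(maximalRealSubfield L)) L (IsCMField.complexConj L) 3 ((StdForm.antidiagonal 3).over L)) :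
      Subgroup (quasiSplit (↥(maximalRealSubfield L)) L (IsCMField.complexConj L) 3).Adelic).subtype) k φ))} :=
  Set.iUnion_subset fun _ => Set.iUnion_subset fun hU₀ => resGMidAtomGenτ_subset_kFiniteGen L μ ξ μω hU₀

omit [(quasiSplit (↥(maximalRealSubfield L)) L (IsCMField.complexConj L) 3).IsAutomorphicMeasure μ] in
/-- **`G_τ ⊆ A_⊥`**: a τ-admissible generator is a generator at `(tauLevel U₀, 1)` (★ `resGMidAtomGenτ_subset`), hence at `(⊥, 1)` (★ level antitone), hence in the level-free atom.
[cite: MoeglinWaldspurger1995, V.3.13] -/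
theorem tauGenerators_subset_resGMidAtom_bot :
    (⋃ (U₀ : Subgroup ↥(finAdelic (↥(maximalRealSubfield L)) L (IsCMField.complexConj L) 3 ((StdForm.antidiagonal 3).over L))) (_ : IsTauLevel L U₀), resGMidAtomGenτ L μ ξ μω U₀) ⊆ (resGMidAtom L μ ξ μω ⊥ 1 : Set ((quasiSplit (↥(maximalRealSubfield L)) L (IsCMField.complexConj L) 3).L2 μ)) :=
  Set.iUnion_subset fun U₀ => Set.iUnion_subset fun _ _ hf =>
    subset_resGMidAtom L μ ξ μω ⊥ 1 (resGMidAtomGen_subset_resGMidAtomGen_bot L μ ξ μω (tauLevel L U₀) 1 (resGMidAtomGenτ_subset L μ ξ μω U₀ hf))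

omit [(quasiSplit (↥(maximalRealSubfield L)) L (IsCMField.complexConj L) 3).IsAutomorphicMeasure μ] in
/-- **`cl span G_τ ≤ A_⊥`** (`A_⊥` is closed ★). [cite: MoeglinWaldspurger1995, V.3.13] -/
theorem closure_span_tauGenerators_le_resGMidAtom_bot :
    (Submodule.span ℂ (⋃ (U₀ : Subgroup ↥(finAdelic (↥(maximalRealSubfield L)) L (IsCMField.complexConj L) 3 ((StdForm.antidiagonal 3).over L))) (_ : IsTauLevel L U₀), resGMidAtomGenτ L μ ξ μω U₀)).topologicalClosure ≤ resGMidAtom L μ ξ μω ⊥ 1 :=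
  Submodule.topologicalClosure_minimal _ (Submodule.span_le.2 (tauGenerators_subset_resGMidAtom_bot L μ ξ μω)) (isClosed_resGMidAtom L μ ξ μω ⊥ 1)

/-! ## §2 `hTRANSτ` ⇒ the τ-block is the closed span of the τ-generators; with `hW1`: (W1) and `B ≤ A_⊥` -/

/-- **`hTRANSτ` ⇒ `resGMidBlockτ ≤ cl span G_τ`**: the closed span of the τ-admissible generators is `R(g)`-stable for every `g` (`R(g)` continuous, `hTRANSτ` on generators) and contains every
τ-atom, so ★ minimality `resGMidBlockτ_le` applies. [cite: MoeglinWaldspurger1995, II.1, V.3.13] [cite: BorelJacquet1979, §4.6] -/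
theorem toSubmodule_resGMidBlockτ_le_closure_span_of_translation
    (hTRANS : ∀ g : (quasiSplit (↥(maximalRealSubfield L)) L (IsCMField.complexConj L) 3).Adelic, ∀ f ∈ (⋃ (U₀ : Subgroup ↥(finAdelic (↥(maximalRealSubfield L)) L (IsCMField.complexConj L) 3 ((StdForm.antidiagonal 3).over L))) (_ : IsTauLevel L U₀), resGMidAtomGenτ L μ ξ μω U₀),
      ((quasiSplit (↥(maximalRealSubfield L)) L (IsCMField.complexConj L) 3).rightRegular μ) g f ∈ (Submodule.span ℂ (⋃ (U₀ : Subgroup ↥(finAdelic (↥(maximalRealSubfield L)) L (IsCMField.complexConj L) 3 ((StdForm.antidiagonal 3).over L))) (_ : IsTauLevel L U₀), resGMidAtomGenτ L μ ξ μω U₀)).topologicalClosure) :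
    (resGMidBlockτ L μ ξ μω).toSubmodule ≤ (Submodule.span ℂ (⋃ (U₀ : Subgroup ↥(finAdelic (↥(maximalRealSubfield L)) L (IsCMField.complexConj L) 3 ((StdForm.antidiagonal 3).over L))) (_ : IsTauLevel L U₀), resGMidAtomGenτ L μ ξ μω U₀)).topologicalClosure := by
  -- invariance of the closed span
  have hinv : ∀ g : (quasiSplit (↥(maximalRealSubfield L)) L (IsCMField.complexConj L) 3).Adelic, ∀ f ∈ (Submodule.span ℂ (⋃ (U₀ : Subgroup ↥(finAdelic (↥(maximalRealSubfield L)) L (IsCMField.complexConj L) 3 ((StdForm.antidiagonal 3).over L))) (_ : IsTauLevel L U₀), resGMidAtomGenτ L μ ξ μω U₀)).topologicalClosure,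
      ((quasiSplit (↥(maximalRealSubfield L)) L (IsCMField.complexConj L) 3).rightRegular μ) g f ∈ (Submodule.span ℂ (⋃ (U₀ : Subgroup ↥(finAdelic (↥(maximalRealSubfield L)) L (IsCMField.complexConj L) 3 ((StdForm.antidiagonal 3).over L))) (_ : IsTauLevel L U₀), resGMidAtomGenτ L μ ξ μω U₀)).topologicalClosure := by
    intro g f hf
    have hspan : (Submodule.span ℂ (⋃ (U₀ : Subgroup ↥(finAdelic (↥(maximalRealSubfield L)) L (IsCMField.complexConj L) 3 ((StdForm.antidiagonal 3).over L))) (_ : IsTauLevel L U₀), resGMidAtomGenτ L μ ξ μω U₀)).map ((((quasiSplit (↥(maximalRealSubfield L)) L (IsCMField.complexConj L) 3).rightRegular μ) g : (quasiSplit (↥(maximalRealSubfield L)) L (IsCMField.complexConj L) 3).L2 μ →L[ℂ] (quasiSplit (↥(maximalRealSubfield L)) L (IsCMField.complexConj L) 3).L2 μ) : (quasiSplit (↥(maximalRealSubfield L)) L (IsCMField.complexConj L) 3).L2 μ →ₗ[ℂ] (quasiSplit (↥(maximalRealSubfield L)) L (IsCMField.complexConj L) 3).L2 μ) ≤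
        (Submodule.span ℂ (⋃ (U₀ : Subgroup ↥(finAdelic (↥(maximalRealSubfield L)) L (IsCMField.complexConj L) 3 ((StdForm.antidiagonal 3).over L))) (_ : IsTauLevel L U₀), resGMidAtomGenτ L μ ξ μω U₀)).topologicalClosure := by
      rw [Submodule.map_span_le]
      exact fun f' hf' => hTRANS g f' hf'
    have hcl := (Submodule.topologicalClosure_map (((quasiSplit (↥(maximalRealSubfield L)) L (IsCMField.complexConj L) 3).rightRegular μ) g) (Submodule.span ℂ (⋃ (U₀ : Subgroup ↥(finAdelic (↥(maximalRealSubfield L)) L (IsCMField.complexConj L) 3 ((StdForm.antidiagonal 3).over L))) (_ : IsTauLevel L U₀), resGMidAtomGenτ L μ ξ μω U₀))).trans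
      ((Submodule.topologicalClosure_mono hspan).trans (Submodule.isClosed_topologicalClosure _).submodule_topologicalClosure_eq.le)
    exact hcl ⟨f, hf, rfl⟩
  refine ClosedSubrep.toSubmodule_le_iff.mpr (resGMidBlockτ_le L μ ξ μω
    ⟨⟨(Submodule.span ℂ (⋃ (U₀ : Subgroup ↥(finAdelic (↥(maximalRealSubfield L)) L (IsCMField.complexConj L) 3 ((StdForm.antidiagonal 3).over L))) (_ : IsTauLevel L U₀), resGMidAtomGenτ L μ ξ μω U₀)).topologicalClosure, fun g _ hf => hinv g _ hf⟩, Submodule.isClosed_topologicalClosure _⟩ fun U₀ hU₀ => ?_)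
  -- every τ-atom lies in the closed span of `G_τ`
  show resGMidAtomτ L μ ξ μω U₀ ≤ (Submodule.span ℂ (⋃ (U₀ : Subgroup ↥(finAdelic (↥(maximalRealSubfield L)) L (IsCMField.complexConj L) 3 ((StdForm.antidiagonal 3).over L))) (_ : IsTauLevel L U₀), resGMidAtomGenτ L μ ξ μω U₀)).topologicalClosure
  rw [resGMidAtomτ_def]
  exact Submodule.topologicalClosure_mono (Submodule.span_mono (Set.subset_iUnion_of_subset U₀ (Set.subset_iUnion_of_subset hU₀ Set.Subset.rfl)))

/-- **`hW1` + `hTRANSτ` ⇒ `resGMidBlock ≤ A_⊥`** (the hull IS the level-free atom: `B ≤ B_τ ≤ cl span G_τ ≤ A_⊥ ≤ B`). [cite: MoeglinWaldspurger1995, V.3.13] -/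
theorem toSubmodule_resGMidBlock_le_resGMidAtom_bot_of_tau
    (hW1 : resGMidBlock L μ ξ μω ≤ resGMidBlockτ L μ ξ μω)
    (hTRANS : ∀ g : (quasiSplit (↥(maximalRealSubfield L)) L (IsCMField.complexConj L) 3).Adelic, ∀ f ∈ (⋃ (U₀ : Subgroup ↥(finAdelic (↥(maximalRealSubfield L)) L (IsCMField.complexConj L) 3 ((StdForm.antidiagonal 3).over L))) (_ : IsTauLevel L U₀), resGMidAtomGenτ L μ ξ μω U₀),
      ((quasiSplit (↥(maximalRealSubfield L)) L (IsCMField.complexConj L) 3).rightRegular μ) g f ∈ (Submodule.span ℂ (⋃ (U₀ : Subgroup ↥(finAdelic (↥(maximalRealSubfield L)) L (IsCMField.complexConj L) 3 ((StdForm.antidiagonal 3).over L))) (_ : IsTauLevel L U₀), resGMidAtomGenτ L μ ξ μω U₀)).topologicalClosure) :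
    (resGMidBlock L μ ξ μω).toSubmodule ≤ resGMidAtom L μ ξ μω ⊥ 1 :=
  (ClosedSubrep.toSubmodule_le_iff.mpr hW1).trans ((toSubmodule_resGMidBlockτ_le_closure_span_of_translation L μ ξ μω hTRANS).trans
    (closure_span_tauGenerators_le_resGMidAtom_bot L μ ξ μω))

/-- **`hW1` + `hTRANSτ` ⇒ the `K_max`-FINITE DENSITY (W1)**: `A_⊥ ≤ resGMidBlock ≤ cl span G_τ ≤ cl span G_fin` (§1). [cite: MoeglinWaldspurger1995, I.2.17, V.3.13] -/
theorem resGMidAtom_bot_le_closure_span_kFinite_of_tau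
    (hW1 : resGMidBlock L μ ξ μω ≤ resGMidBlockτ L μ ξ μω)
    (hTRANS : ∀ g : (quasiSplit (↥(maximalRealSubfield L)) L (IsCMField.complexConj L) 3).Adelic, ∀ f ∈ (⋃ (U₀ : Subgroup ↥(finAdelic (↥(maximalRealSubfield L)) L (IsCMField.complexConj L) 3 ((StdForm.antidiagonal 3).over L))) (_ : IsTauLevel L U₀), resGMidAtomGenτ L μ ξ μω U₀),
      ((quasiSplit (↥(maximalRealSubfield L)) L (IsCMField.complexConj L) 3).rightRegular μ) g f ∈ (Submodule.span ℂ (⋃ (U₀ : Subgroup ↥(finAdelic (↥(maximalRealSubfield L)) L (IsCMField.complexConj L) 3 ((StdForm.antidiagonal 3).over L))) (_ : IsTauLevel L U₀), resGMidAtomGenτ L μ ξ μω U₀)).topologicalClosure) :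
    resGMidAtom L μ ξ μω ⊥ 1 ≤ (Submodule.span ℂ {f : (quasiSplit (↥(maximalRealSubfield L)) L (IsCMField.complexConj L) 3).L2 μ | ∃ φ : (quasiSplit (↥(maximalRealSubfield L)) L (IsCMField.complexConj L) 3).Adelic → ℂ, (φ ∈ chiSectionSpacePair (ξ.bcη⁻¹ * ξ.bcψ⁻¹ * μω) ξ.ψ (⊥ : Subgroup (quasiSplit (↥(maximalRealSubfield L)) L (IsCMField.complexConj L) 3).Adelic)
          ((1 : ↥(⊥ : Subgroup (quasiSplit (↥(maximalRealSubfield L)) L (IsCMField.complexConj L) 3).Adelic) →* ℂ) : ↥(⊥ : Subgroup (quasiSplit (↥(maximalRealSubfield L)) L (IsCMField.complexConj L) 3).Adelic) → ℂ) ∧ Continuous φ ∧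
          ∃ (Ec : ℂ → (quasiSplit (↥(maximalRealSubfield L)) L (IsCMField.complexConj L) 3).Adelic → ℂ) (Sp : Finset ℂ)
            (_ : ∀ s ∈ Sp, s.im = 0 ∧ 1 < s.re ∧ s.re ≤ 2)
            (_ : ∀ g, DifferentiableOn ℂ (fun z => Ec z g) ({z : ℂ | 1 < z.re} \ (↑Sp : Set ℂ)))
            (_ : ∀ z : ℂ, 2 < z.re → Ec z = eisensteinSeriesU (flatSectionU φ z))
            (Fp : (quasiSplit (↥(maximalRealSubfield L)) L (IsCMField.complexConj L) 3).Adelic → ℂ → ℂ)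
            (_ : ∀ g, AnalyticAt ℂ (Fp g) ((3 : ℂ) / 2))
            (_ : ∀ g, Fp g =ᶠ[𝓝[≠] ((3 : ℂ) / 2)] fun z => (z - (3 : ℂ) / 2) * Ec z g),
            (f : (quasiSplit (↥(maximalRealSubfield L)) L (IsCMField.complexConj L) 3).automorphicQuotient → ℂ) =ᵐ[μ] (fun x : (quasiSplit (↥(maximalRealSubfield L)) L (IsCMField.complexConj L) 3).automorphicQuotient => Fp (Quotient.out (x : ((quasiSplit (↥(maximalRealSubfield L)) L (IsCMField.complexConj L) 3).Adelic ⧸ (quasiSplit (↥(maximalRealSubfield L)) L (IsCMField.complexConj L) 3).quotientSubgroup)))⁻¹ ((3 : ℂ) / 2))) ∧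
          FiniteDimensional ℂ ↥(Submodule.span ℂ (Set.range fun k : ↥((standardMaximalCompactGL 3 L).comap (adelicVal (↥(maximalRealSubfield L)) L (IsCMField.complexConj L) 3 ((StdForm.antidiagonal 3).over L)) :
      Subgroup (quasiSplit (↥(maximalRealSubfield L)) L (IsCMField.complexConj L) 3).Adelic) => ((rightTranslation (quasiSplit (↥(maximalRealSubfield L)) L (IsCMField.complexConj L) 3)).comp ((standardMaximalCompactGL 3 L).comap (adelicVal (↥(maximalRealSubfield L)) L (IsCMField.complexConj L) 3 ((StdForm.antidiagonal 3).over L)) :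
      Subgroup (quasiSplit (↥(maximalRealSubfield L)) L (IsCMField.complexConj L) 3).Adelic).subtype) k φ))}).topologicalClosure :=
  (resGMidAtom_le_resGMidBlock L μ ξ μω ⊥ 1).trans ((ClosedSubrep.toSubmodule_le_iff.mpr hW1).trans
    ((toSubmodule_resGMidBlockτ_le_closure_span_of_translation L μ ξ μω hTRANS).trans
      (Submodule.topologicalClosure_mono (Submodule.span_mono (tauGenerators_subset_kFiniteGen L μ ξ μω)))))

/-! ## §3 `hDISC` of record in the τ-vocabulary -/

/-- **`hDISC` FOR ONE `(L, μ, ξ, μω)` FROM {`hW1`, `hTRANSτ`}** (`μω` unitary): (W1) from §2, hence (W1′) (★ β2) and the admissibility of `A_⊥` (★ p863995 with ★ `hSUM_holds`); `B ≤ A_⊥` from §2;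
★ p863816's generic descent `finiteDimensional_homRangeSum_toContRep_of_le_of_adm`. [cite: WallachRRG1, §3.3.1] [cite: MoeglinWaldspurger1995, I.2.18, V.3.13] -/
theorem finiteDimensional_homRangeSum_resGMidBlock_of_tau (hμu : μω.IsUnitary)
    (hW1 : resGMidBlock L μ ξ μω ≤ resGMidBlockτ L μ ξ μω)
    (hTRANS : ∀ g : (quasiSplit (↥(maximalRealSubfield L)) L (IsCMField.complexConj L) 3).Adelic, ∀ f ∈ (⋃ (U₀ : Subgroup ↥(finAdelic (↥(maximalRealSubfield L)) L (IsCMField.complexConj L) 3 ((StdForm.antidiagonal 3).over L))) (_ : IsTauLevel L U₀), resGMidAtomGenτ L μ ξ μω U₀),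
      ((quasiSplit (↥(maximalRealSubfield L)) L (IsCMField.complexConj L) 3).rightRegular μ) g f ∈ (Submodule.span ℂ (⋃ (U₀ : Subgroup ↥(finAdelic (↥(maximalRealSubfield L)) L (IsCMField.complexConj L) 3 ((StdForm.antidiagonal 3).over L))) (_ : IsTauLevel L U₀), resGMidAtomGenτ L μ ξ μω U₀)).topologicalClosure) :
    ∀ (E : Submodule ℂ (resGMidBlock L μ ξ μω).toSubmodule)
      (hE : ∀ k, ∀ x ∈ E, ((resGMidBlock L μ ξ μω).toContRep.restrict (((standardMaximalCompactGL 3 L).comap (adelicVal (↥(maximalRealSubfield L)) L (IsCMField.complexConj L) 3 ((StdForm.antidiagonal 3).over L)) : Subgroup (quasiSplit (↥(maximalRealSubfield L)) L (IsCMField.complexConj L) 3).Adelic)).subtype) k x ∈ E), FiniteDimensional ℂ E →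
      (((resGMidBlock L μ ξ μω).toContRep.restrict (((standardMaximalCompactGL 3 L).comap (adelicVal (↥(maximalRealSubfield L)) L (IsCMField.complexConj L) 3 ((StdForm.antidiagonal 3).over L)) : Subgroup (quasiSplit (↥(maximalRealSubfield L)) L (IsCMField.complexConj L) 3).Adelic)).subtype).subRep E hE).IsIrreducible →
      FiniteDimensional ℂ (Representation.homRangeSum ((resGMidBlock L μ ξ μω).toContRep.restrict (((standardMaximalCompactGL 3 L).comap (adelicVal (↥(maximalRealSubfield L)) L (IsCMField.complexConj L) 3 ((StdForm.antidiagonal 3).over L)) : Subgroup (quasiSplit (↥(maximalRealSubfield L)) L (IsCMField.complexConj L) 3).Adelic)).subtype).toRepresentation (((resGMidBlock L μ ξ μω).toContRep.restrict (((standardMaximalCompactGL 3 L).comap (adelicVal (↥(maximalRealSubfield L)) L (IsCMField.complexConj L) 3 ((StdForm.antidiagonal 3).over L)) : Subgroup (quasiSplit (↥(maximalRealSubfield L)) L (IsCMField.complexConj L) 3).Adelic)).subtype).subRep E hE)) :=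
  finiteDimensional_homRangeSum_toContRep_of_le_of_adm ((quasiSplit (↥(maximalRealSubfield L)) L (IsCMField.complexConj L) 3).rightRegular μ) ((standardMaximalCompactGL 3 L).comap (adelicVal (↥(maximalRealSubfield L)) L (IsCMField.complexConj L) 3 ((StdForm.antidiagonal 3).over L)) :
      Subgroup (quasiSplit (↥(maximalRealSubfield L)) L (IsCMField.complexConj L) 3).Adelic).subtype (resGMidBlock L μ ξ μω) (resGMidAtom L μ ξ μω ⊥ 1) (restrict_apply_mem_resGMidAtom_bot L μ ξ μω)
    (toSubmodule_resGMidBlock_le_resGMidAtom_bot_of_tau L μ ξ μω hW1 hTRANS)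
    fun E _ hE hfd hirr => finiteDimensional_homRangeSum_resGMidAtom_bot_of_letters L μ ξ μω (hSUM_holds L μ μω hμu ξ)
      (hW1prime_of_kFinite L μ ξ μω (hSUM_holds L μ μω hμu ξ) (resGMidAtom_bot_le_closure_span_kFinite_of_tau L μ ξ μω hW1 hTRANS))
      (restrict_apply_mem_resGMidAtom_bot L μ ξ μω) E hE hfd hirr

end Main

/-- **`hDISC` OF RECORD IN THE τ-VOCABULARY** — conclusion = the `hDISC` binder bytes of ★ p863422 ∕ p863518 VERBATIM; hypotheses ∀-closed in the same frame: `hW1` = K2E1-p10 (g5)'s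
`resGMidBlock ≤ resGMidBlockτ` (the SHARED density letter of the (R)′ row) and `hTRANSτ` («right translates of τ-admissible generators stay in the closed span of the τ-admissible
generators» = invariance of the `K`-finite residue span [MW95 II.1, V.3.13; BJ79 §4.6]).  THE LEDGER: `hDISC` = ★ ∘ {`hW1`, `hTRANSτ`}. [cite: MoeglinWaldspurger1995, I.2.17–I.2.18, V.3.13]
[cite: Rogawski1990, §13.9 p. 229 (ii)] -/
theorem hDISC_of_tauRecord
    (hW1 : ∀ (L : Type) [Field L] [NumberField L] [IsCMField L]
      (μ : Measure (quasiSplit (↥(maximalRealSubfield L)) L (IsCMField.complexConj L) 3).automorphicQuotient) [(quasiSplit (↥(maximalRealSubfield L)) L (IsCMField.complexConj L) 3).IsAutomorphicMeasure μ]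
      (μω : HeckeCharacter L) (_ : μω.IsUnitary) (ξ : OneDimAutRepH L), resGMidBlock L μ ξ μω ≤ resGMidBlockτ L μ ξ μω)
    (hTRANS : ∀ (L : Type) [Field L] [NumberField L] [IsCMField L]
      (μ : Measure (quasiSplit (↥(maximalRealSubfield L)) L (IsCMField.complexConj L) 3).automorphicQuotient) [(quasiSplit (↥(maximalRealSubfield L)) L (IsCMField.complexConj L) 3).IsAutomorphicMeasure μ]
      (μω : HeckeCharacter L) (_ : μω.IsUnitary) (ξ : OneDimAutRepH L), ∀ g : (quasiSplit (↥(maximalRealSubfield L)) L (IsCMField.complexConj L) 3).Adelic, ∀ f ∈ (⋃ (U₀ : Subgroup ↥(finAdelic (↥(maximalRealSubfield L)) L (IsCMField.complexConj L) 3 ((StdForm.antidiagonal 3).over L))) (_ : IsTauLevel L U₀), resGMidAtomGenτ L μ ξ μω U₀),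
      ((quasiSplit (↥(maximalRealSubfield L)) L (IsCMField.complexConj L) 3).rightRegular μ) g f ∈ (Submodule.span ℂ (⋃ (U₀ : Subgroup ↥(finAdelic (↥(maximalRealSubfield L)) L (IsCMField.complexConj L) 3 ((StdForm.antidiagonal 3).over L))) (_ : IsTauLevel L U₀), resGMidAtomGenτ L μ ξ μω U₀)).topologicalClosure) :
    ∀ (L : Type) [Field L] [NumberField L] [IsCMField L]
      (μ : Measure (quasiSplit (↥(maximalRealSubfield L)) L (IsCMField.complexConj L) 3).automorphicQuotient) [(quasiSplit (↥(maximalRealSubfield L)) L (IsCMField.complexConj L) 3).IsAutomorphicMeasure μ]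
      (μω : HeckeCharacter L) (_ : μω.IsUnitary) (ξ : OneDimAutRepH L), ∀ (E : Submodule ℂ (resGMidBlock L μ ξ μω).toSubmodule)
          (hE : ∀ k, ∀ x ∈ E, ((resGMidBlock L μ ξ μω).toContRep.restrict (((standardMaximalCompactGL 3 L).comap (adelicVal (↥(maximalRealSubfield L)) L (IsCMField.complexConj L) 3 ((StdForm.antidiagonal 3).over L)) : Subgroup (quasiSplit (↥(maximalRealSubfield L)) L (IsCMField.complexConj L) 3).Adelic)).subtype) k x ∈ E), FiniteDimensional ℂ E →
          (((resGMidBlock L μ ξ μω).toContRep.restrict (((standardMaximalCompactGL 3 L).comap (adelicVal (↥(maximalRealSubfield L)) L (IsCMField.complexConj L) 3 ((StdForm.antidiagonal 3).over L)) : Subgroup (quasiSplit (↥(maximalRealSubfield L)) L (IsCMField.complexConj L) 3).Adelic)).subtype).subRep E hE).IsIrreducible →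
          FiniteDimensional ℂ (Representation.homRangeSum ((resGMidBlock L μ ξ μω).toContRep.restrict (((standardMaximalCompactGL 3 L).comap (adelicVal (↥(maximalRealSubfield L)) L (IsCMField.complexConj L) 3 ((StdForm.antidiagonal 3).over L)) : Subgroup (quasiSplit (↥(maximalRealSubfield L)) L (IsCMField.complexConj L) 3).Adelic)).subtype).toRepresentation (((resGMidBlock L μ ξ μω).toContRep.restrict (((standardMaximalCompactGL 3 L).comap (adelicVal (↥(maximalRealSubfield L)) L (IsCMField.complexConj L) 3 ((StdForm.antidiagonal 3).over L)) : Subgroup (quasiSplit (↥(maximalRealSubfield L)) L (IsCMField.complexConj L) 3).Adelic)).subtype).subRep E hE)) :=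
  fun L _ _ _ μ _ μω hμu ξ => finiteDimensional_homRangeSum_resGMidBlock_of_tau L μ ξ μω hμu (hW1 L μ μω hμu ξ) (hTRANS L μ μω hμu ξ)

end Summit.HodgeConjecture.HodgeConjecture.R90.S8

end
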